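import Literature.NumberTheory.EllipticCurves.PAdicOneVariableSeriesFamilyOfRelNormCoherentUnits
import Literature.NumberTheory.EllipticCurves.PAdicOneVariableSocketCoatesWilesTwo
import HarnessLib

set_option autoImplicit false

/-!
# The READ₂-REFL engine at `q = 2`: the twisted tilde is HALF THE REFLECTION-ANTI-INVARIANT PART
# (`2·(δ_E g_β)~ = δ_E(g_β/τ_E g_β)`), the reflection quotient `Q_β ≡ 1 (mod π)`, and their TRANSPORT to the family of
# record `H_β = Θ(j((δ_E g_β)~)∘ϑ)` — de Shalit I.3.3 (7)–(8) at the dyadic prime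

Cell `bsd-print-cf2`, discharge-interface typer `bsd-print-cf2-ty2` g45 (literature-prover seat; Summits-side helpers in the
typer's directory `Rank1Residual/P2/`, Theses-free, no item): port P48 of STUB-PLAN `stub_heegnerIndexLowerAtTwo` (crux
`PrintCf2.SplitBadTwoLowerHalfOfFacts`, stmt-BirchSwinnertonDyer-27851; CRITIC-ROWS-g40 row 116; sketch k3-g39 `a08256b05cf54030`
§D + §E VERBATIM; the `BoundedPrimitive` corollaries are omitted — node R218 is closed log-free by
`PrintCf2SplitBadTwoLogFreePrimitive.lean`). HONEST FRAMING: nothing here proves BSD, the crux or the stub; no named fact, no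
`sorry`. New `def`s: `gUnit`, `reflQuot` (the reflection quotient `g_β/τ_E g_β`), `readΘ`, `transport` (the reading map
`G ↦ Θ(j(G)∘ϑ)`), and two `Prop`-valued receptacles with explicit binders — `TransportedDIdentity` (H5) and
`TransportedCongruence` (H6) — BOTH PROVED here unconditionally (`transportedDIdentity_holds`, `transportedCongruence_holds`);
the comparison chain rule T3 `ω_f·ϑ' = ε·ω_{f'}∘ϑ` is the Literature theorem `comparisonChainRuleC`
(`LubinTateComparisonDifferentialUnramified`), consumed by name.

* §D (tree algebra, PROVED): `two_mul_relTildeSeries` (`2·(δβ)~ = δβ − τ_E(δβ)`: the Frobenius disappears),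
  `two_mul_relTildeSeries_eq_relLogDeriv_reflQuot` (`2·(δ_E g_β)~ = δ_E(Q_β)`), `reflQuot_sub_one_mem` (`Q_β ≡ 1 (mod π)`),
  `relLogDeriv_inv`, `relLogDeriv_mul_self`, `two_mul_relTildeSeries_mul_reflQuot` (division-free: `2·(δβ)~·Q_β = ω_f·Q_β'`).
* §E TRANSPORT: `transport_mul/_add/_eq`, `norm_readΘ_le`,
  `readΘ_coeff_one_admissible` (`Θ(ε)` is a unit of norm `1`), ★★ `transportedCongruence_holds`,
  ★★ `transportedDIdentity_holds`.

References: [deShalit1987] I.3.2 (5), I.3.3 (7), (7′), (8) (p. 17), I.3.5 (11) (p. 18); [LubinTate1965] Lemma p. 385, (17).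
-/

noncomputable section

open scoped PowerSeries.WithPiTopology

namespace Summit.BirchSwinnertonDyer.Rank1Residual.P2.ReflectionPrimitive

open Literature.NumberTheory.EllipticCurves

/-! ### §D. THE LEVER (tree algebra, PROVED): at `q = 2` the twisted tilde is HALF THE REFLECTION-ANTI-INVARIANT PART,
`2 · (δ_E g_β)~ = δ_E g_β − τ_E(δ_E g_β) = δ_E(g_β / τ_E g_β)`, and the reflection quotient is `≡ const (mod π)` -/

section Reflection

open Literature.NumberTheory.GaloisRepresentations
open Literature.NumberTheory.GaloisRepresentations.IsNonarchimedeanLocalField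
open Literature.NumberTheory.GaloisRepresentations.LubinTate ValuativeRel Field

variable {F : Type} [Field F] [ValuativeRel F] [TopologicalSpace F] [IsNonarchimedeanLocalField F]

attribute [local instance] ltNormUniformSpace ltNormIsUniformAddGroup rk1 nF nE fintypeResidueField

variable {π : 𝒪[F]} (hπ : (valuation F).IsUniformizer (π : F))
variable (E : IntermediateField F (AlgebraicClosure F)) [FiniteDimensional F E] [Normal F E] [IsGalois F E]
variable (hq : residueFieldCard F = 2) (hE : E ≤ maxUnramified F) {σ₀ : absoluteGaloisGroup F} (hσ₀ : IsAbsArithFrob σ₀)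

/-- ★ **REFLECTION FORM of the twisted tilde** (`π = 2u`): `2 · (δβ)~ = δβ − τ_E(δβ)`.  From the tree's twisted
eigen-equation `𝒮_E(δβ) = π · (δβ)^φ` (`relTraceTwo_relLogDerivSeries`) and `(𝒮_E h) ∘ f = h + τ_E h`
(`subst_relTraceTwo`): `π · ((δβ)^φ ∘ f) = δβ + τ_E δβ`, so `2u · ((δβ)^φ ∘ f) = δβ + τ_E δβ` and
`2 · (δβ − u · (δβ)^φ ∘ f) = δβ − τ_E δβ`.  The Frobenius has DISAPPEARED.
[folklore] -/
theorem two_mul_relTildeSeries {u : LTCoeff F} (hu : LTCoeff.of F π = residueFieldCard F * u)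
    (β : RelNormCoherentUnits hπ E) :
    (2 : PowerSeries (unitBall E)) * relTildeSeries hπ E hq hE hσ₀ u β =
      relLogDerivSeries hπ E hq hE hσ₀ β - reflE hπ E (relLogDerivSeries hπ E hq hE hσ₀ β) := by
  set h := relLogDerivSeries hπ E hq hE hσ₀ β with hh
  set fS := (ltSer F π).map (algebraMap (LTCoeff F) (unitBall E)) with hfS
  set S := PowerSeries.subst fS (PowerSeries.map (frobUnitBall E σ₀ : unitBall E →+* unitBall E) h) with hS'
  have hs : PowerSeries.HasSubst fS :=
    PowerSeries.HasSubst.of_constantCoeff_zero' ((isLTSeries_ltSer π).map _).constantCoeff_eq_zero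
  -- `(𝒮_E h) ∘ f = h + τ_E h` with `𝒮_E h = C π · h^φ`
  have key : PowerSeries.C (algebraMap 𝒪[F] (unitBall E) π) * S = h + reflE hπ E h := by
    have e := subst_relTraceTwo hπ E hq h
    rw [relTraceTwo_relLogDerivSeries hπ E hq hE hσ₀ β, PowerSeries.subst_mul hs, PowerSeries.subst_C] at e
    exact e
  -- `C π = 2 · C u`
  have hπ2 : PowerSeries.C (algebraMap 𝒪[F] (unitBall E) π) =
      2 * PowerSeries.C (algebraMap (LTCoeff F) (unitBall E) u) := by
    change PowerSeries.C (algebraMap (LTCoeff F) (unitBall E) (LTCoeff.of F π)) = _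
    rw [hu, hq, map_mul, map_natCast, map_mul, map_natCast]
    norm_num
  have e1 : 2 * (PowerSeries.C (algebraMap (LTCoeff F) (unitBall E) u) * S) = h + reflE hπ E h := by
    rw [← mul_assoc, ← hπ2]; exact key
  show (2 : PowerSeries (unitBall E)) * (h - PowerSeries.C (algebraMap (LTCoeff F) (unitBall E) u) * S) =
    h - reflE hπ E h
  rw [mul_sub, e1]
  ring

/-- The relative Coleman series `g_β` as a unit of `𝒪_E⟦X⟧`. [cite: deShalit1987, Ch. I §2.3] -/
def gUnit (β : RelNormCoherentUnits hπ E) : (PowerSeries (unitBall E))ˣ :=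
  (isUnit_relColemanSeries hπ E hq hE hσ₀ β).unit

/-- ★ **THE REFLECTION QUOTIENT `Q_β := g_β / τ_E g_β = g_β(X) / g_β(−π−X)`** (a unit of `𝒪_E⟦X⟧`). -/
def reflQuot (β : RelNormCoherentUnits hπ E) : (PowerSeries (unitBall E))ˣ :=
  gUnit hπ E hq hE hσ₀ β * (reflEUnit hπ E (gUnit hπ E hq hE hσ₀ β))⁻¹

omit [Normal F E] [IsGalois F E] in
/-- `δ_E(G⁻¹) = −δ_E G`. [folklore] -/
theorem relLogDeriv_inv (G : (PowerSeries (unitBall E))ˣ) : relLogDeriv hπ E G⁻¹ = -relLogDeriv hπ E G := by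
  have e := relLogDeriv_mul hπ E G G⁻¹
  rw [mul_inv_cancel, relLogDeriv_one] at e
  exact eq_neg_of_add_eq_zero_right e.symm

/-- ★★ **`2 · (δ_E g_β)~ = δ_E(Q_β)`**: twice the twisted tilde is the logarithmic derivative of the reflection quotient
(`δ_E` is a homomorphism and commutes with `τ_E`: `relLogDeriv_mul`, `relLogDeriv_reflE`).  So a `D`-PRIMITIVE of the
tilde family is `½ · log Q_β`, read through the comparison — the whole content of PRIM₂ is the integrality of that `½`.
[folklore] -/
theorem two_mul_relTildeSeries_eq_relLogDeriv_reflQuot {u : LTCoeff F} (hu : LTCoeff.of F π = residueFieldCard F * u)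
    (β : RelNormCoherentUnits hπ E) :
    (2 : PowerSeries (unitBall E)) * relTildeSeries hπ E hq hE hσ₀ u β = relLogDeriv hπ E (reflQuot hπ E hq hE hσ₀ β) := by
  rw [two_mul_relTildeSeries hπ E hq hE hσ₀ hu β, reflQuot, relLogDeriv_mul, relLogDeriv_inv, relLogDeriv_reflE,
    ← sub_eq_add_neg]
  rfl

/-- ★ **REFLECTION CONGRUENCE**: `Q_β ≡ 1 (mod π)` coefficientwise — from the tree's `τ_E G ≡ G (mod π)`
(`reflE_sub_self_mem_span`: `X [+] ω₁ − X = −2X − π ∈ (π)` as `2 = π t`). [folklore] -/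
theorem reflQuot_sub_one_mem (β : RelNormCoherentUnits hπ E) :
    (reflQuot hπ E hq hE hσ₀ β : PowerSeries (unitBall E)) - 1 ∈
      coeffIdeal (Ideal.span {algebraMap 𝒪[F] (unitBall E) π}) := by
  have hτ := reflE_sub_self_mem_span hπ E hq (gUnit hπ E hq hE hσ₀ β : PowerSeries (unitBall E))
  have hinv : (reflEUnit hπ E (gUnit hπ E hq hE hσ₀ β) : PowerSeries (unitBall E)) *
      ↑(reflEUnit hπ E (gUnit hπ E hq hE hσ₀ β))⁻¹ = 1 := Units.mul_inv _
  -- `Q − 1 = −(τg − g) · (τg)⁻¹`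
  have e : (reflQuot hπ E hq hE hσ₀ β : PowerSeries (unitBall E)) - 1 =
      -(reflE hπ E (gUnit hπ E hq hE hσ₀ β : PowerSeries (unitBall E)) - ↑(gUnit hπ E hq hE hσ₀ β)) *
        ↑(reflEUnit hπ E (gUnit hπ E hq hE hσ₀ β))⁻¹ := by
    rw [reflQuot, Units.val_mul, ← coe_reflEUnit]
    linear_combination hinv
  rw [e]
  exact Ideal.mul_mem_right _ _ (neg_mem hτ)

omit [Normal F E] [IsGalois F E] in
/-- `δ_E Q · Q = ω_{f} · Q'` — the logarithmic derivative without division (`dlog G · G = G'`).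
[cite: deShalit1987, Ch. I §3.5 (11) (p. 18)] -/
theorem relLogDeriv_mul_self (G : (PowerSeries (unitBall E))ˣ) :
    relLogDeriv hπ E G * (G : PowerSeries (unitBall E)) =
      (invDiff (isLTRing_LTCoeff hπ) (isLTSeries_LTCoeff π)).map (algebraMap (LTCoeff F) (unitBall E)) *
        PowerSeries.derivative (unitBall E) (G : PowerSeries (unitBall E)) := by
  rw [relLogDeriv_def, PowerSeries.dlog_def, mul_assoc, mul_assoc, Units.inv_mul, mul_one]

/-- ★★ **THE REFLECTION IDENTITY, division-free** (what gets transported through `j`, `ϑ`, `Θ`):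
`2 · (δ_E g_β)~ · Q_β = ω_f · Q_β'`. [folklore] -/
theorem two_mul_relTildeSeries_mul_reflQuot {u : LTCoeff F} (hu : LTCoeff.of F π = residueFieldCard F * u)
    (β : RelNormCoherentUnits hπ E) :
    (2 : PowerSeries (unitBall E)) * relTildeSeries hπ E hq hE hσ₀ u β * (reflQuot hπ E hq hE hσ₀ β : PowerSeries (unitBall E)) =
      (invDiff (isLTRing_LTCoeff hπ) (isLTSeries_LTCoeff π)).map (algebraMap (LTCoeff F) (unitBall E)) *
        PowerSeries.derivative (unitBall E) (reflQuot hπ E hq hE hσ₀ β : PowerSeries (unitBall E)) := by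
  rw [two_mul_relTildeSeries_eq_relLogDeriv_reflQuot hπ E hq hE hσ₀ hu β, relLogDeriv_mul_self]

end Reflection

/-! ### §E. TRANSPORT to the family of record `H_β = Θ(j((δ_E g_β)~) ∘ ϑ)` and the split of R218 -/

section Transport

open Literature.NumberTheory.GaloisRepresentations
open Literature.NumberTheory.GaloisRepresentations.IsNonarchimedeanLocalField
open Literature.NumberTheory.GaloisRepresentations.LubinTate ValuativeRel Field
open Literature.NumberTheory.PAdicHodge

variable {F : Type} [Field F] [ValuativeRel F] [TopologicalSpace F] [IsNonarchimedeanLocalField F]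

attribute [local instance] ltNormUniformSpace ltNormIsUniformAddGroup rk1 nF nE fintypeResidueField

variable (h2 : (valuation F).IsUniformizer (((2 : ℕ) : 𝒪[F]) : F)) (u : 𝒪[F]ˣ)
variable (E : IntermediateField F (AlgebraicClosure F)) [FiniteDimensional F E] [Normal F E] [IsGalois F E]
  (hq : residueFieldCard F = 2) (hE : E ≤ maxUnramified F) {σ₀ : absoluteGaloisGroup F} (hσ₀ : IsAbsArithFrob σ₀)
  (j : unitBall E →+* UnrCoeff F)
variable {ε : (maxUnramifiedCompletion F)ˣ}
  (hε : maxUnramifiedCompletion.galAut F σ₀ (ε : maxUnramifiedCompletion F) =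
    algebraMap 𝒪[F] (maxUnramifiedCompletion F) (u : 𝒪[F]) * (ε : maxUnramifiedCompletion F))
variable (θ : CompletedAlgClosure F →+* ℂ_[2])

/-- The reading map `Θ = θ ∘ (𝒪_{ℂ_F} ⊆ ℂ_F) ∘ (𝐃 → 𝒪_{ℂ_F}) : 𝐃 → ℂ₂` of the family of record. -/
def readΘ : UnrCoeff F →+* ℂ_[2] := θ.comp ((CBall F).subtype.comp (algebraMap (UnrCoeff F) (CBall F)))

/-- The TRANSPORT `L(G) := Θ(j(G) ∘ ϑ) : 𝒪_E⟦X⟧ → ℂ₂⟦S⟧` of the family of record (`H_β = L((δ_E g_β)~)`). -/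
def transport (G : PowerSeries (unitBall E)) : PowerSeries ℂ_[2] :=
  (PowerSeries.subst (compSeriesC h2 hσ₀ u hε) (G.map j)).map (readΘ θ)

/-- ★ **SUB-STUB H5 «TRANSPORTED D-IDENTITY»** (typed, size S⁻): `2Θ(ε) · H_β · V_β = (1+S) · V_β'` with
`V_β := L(Q_β)`.  ⟸ §D `two_mul_relTildeSeries_mul_reflQuot` (PROVED: `2·(δβ)~·Q_β = ω_f·Q_β'` in `𝒪_E⟦X⟧`) applied
through the ring map `L`, + the comparison chain rule (Literature `comparisonChainRuleC`) + `PowerSeries.derivative_subst` /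
`derivative_map` + `hj` (to identify `L(ω_f)` with `Θ(ω_{f'}∘ϑ)`); proved below (`transportedDIdentity_holds`).
[cite: deShalit1987, I.3.3 (8) (p. 17), I.3.5] -/
def TransportedDIdentity : Prop :=
  ∀ β : RelNormCoherentUnits (isUniformizer_unit_mul h2 u) E,
    PowerSeries.C (2 * readΘ θ (PowerSeries.coeff 1 (compSeriesC h2 hσ₀ u hε))) *
          transport h2 u E hσ₀ j hε θ
            (relTildeSeries (isUniformizer_unit_mul h2 u) E hq hE hσ₀ (LTCoeff.of F (u : 𝒪[F])) β) *
        transport h2 u E hσ₀ j hε θ (reflQuot (isUniformizer_unit_mul h2 u) E hq hE hσ₀ β : PowerSeries (unitBall E)) =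
      (1 + PowerSeries.X) * PowerSeries.derivative ℂ_[2]
        (transport h2 u E hσ₀ j hε θ (reflQuot (isUniformizer_unit_mul h2 u) E hq hE hσ₀ β : PowerSeries (unitBall E)))

/-- ★ **SUB-STUB H6 «TRANSPORTED CONGRUENCE»** (typed, size XS–S): `‖[S^k](V_β − 1)‖ ≤ ‖2‖` for `V_β = L(Q_β)`.
⟸ §D `reflQuot_sub_one_mem` (PROVED: `Q_β ≡ 1 (mod π')` coefficientwise) + coefficient bookkeeping through `map j`
(`hj`: `j(π') = ι(π')`), `subst ϑ` (finite sums `Σ_d [X^d](Q−1)·[S^k]ϑ^d`, `ϑ(0) = 0`) and `map Θ` (`‖Θ(x)‖ ≤ 1`,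
`‖Θ(ι π')‖ = ‖2u‖ = ‖2‖`). [folklore] -/
def TransportedCongruence : Prop :=
  ∀ β : RelNormCoherentUnits (isUniformizer_unit_mul h2 u) E, ∀ k : ℕ,
    ‖PowerSeries.coeff k
        (transport h2 u E hσ₀ j hε θ (reflQuot (isUniformizer_unit_mul h2 u) E hq hE hσ₀ β : PowerSeries (unitBall E)) - 1)‖ ≤
      ‖(2 : ℂ_[2])‖

variable (hθ1 : ∀ z : CBall F, ‖θ (z : CompletedAlgClosure F)‖ ≤ 1)

omit [Normal F E] [IsGalois F E] in
include hθ1 in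
/-- `‖Θ(x)‖ ≤ 1` on `𝐃`. [folklore] -/
theorem norm_readΘ_le (x : UnrCoeff F) : ‖readΘ θ x‖ ≤ 1 := hθ1 _

omit [Normal F E] [IsGalois F E] in
include hθ1 in
/-- **`e := Θ(ε)` is admissible** (PROVED): `ε = [S]ϑ` is a unit of `𝐃` (`isUnit_coeff_one_compSeriesC`), so `Θ(ε) ≠ 0`
and `‖Θ(ε)⁻¹‖ = ‖Θ(ε⁻¹)‖ ≤ 1`. [cite: LubinTate1965, Lemma p. 385] -/
theorem readΘ_coeff_one_admissible :
    readΘ θ (PowerSeries.coeff 1 (compSeriesC h2 hσ₀ u hε)) ≠ 0 ∧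
      ‖(readΘ θ (PowerSeries.coeff 1 (compSeriesC h2 hσ₀ u hε)))⁻¹‖ ≤ 1 := by
  obtain ⟨v, hv⟩ := isUnit_coeff_one_compSeriesC h2 hσ₀ u hε
  rw [← hv]
  have hmul : readΘ θ (v : UnrCoeff F) * readΘ θ (↑v⁻¹ : UnrCoeff F) = 1 := by
    rw [← map_mul, Units.mul_inv, map_one]
  have hne : readΘ θ (v : UnrCoeff F) ≠ 0 := fun h0 => by
    rw [h0, zero_mul] at hmul; exact zero_ne_one hmul
  refine ⟨hne, ?_⟩
  rw [← mul_eq_one_iff_eq_inv₀ hne |>.mp (by rw [mul_comm]; exact hmul)]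
  exact norm_readΘ_le θ hθ1 _

variable (hj : j.comp (algebraMap (LTCoeff F) (unitBall E)) = (intToUnrCoeff F).comp (LTCoeff.of F).symm.toRingHom)

include hj hθ1 in
/-- ★★ **H6 «TRANSPORTED CONGRUENCE» IS PROVED** (given `hj`, `hθ1` of the family of record): `Q_β ≡ 1 (mod π')` in
`𝒪_E⟦X⟧` (§D) survives `map j` (`j(π') = ι(π')`), `subst ϑ` (finite sums, `ϑ(0) = 0`) and `map Θ` (`‖Θ‖ ≤ 1`,
`‖Θ(ι(2u))‖ ≤ ‖2‖`).  With `transportedDIdentity_holds` below, H5 and H6 are both unconditional in this file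
(T3 = Literature `comparisonChainRuleC`). [cite: deShalit1987, I.3.3 (7)–(8) (p. 17)] -/
theorem transportedCongruence_holds : TransportedCongruence h2 u E hq hE hσ₀ j hε θ := by
  intro β k
  set π' : 𝒪[F] := (u : 𝒪[F]) * ((2 : ℕ) : 𝒪[F]) with hπ'
  set Q : PowerSeries (unitBall E) :=
    (reflQuot (isUniformizer_unit_mul h2 u) E hq hE hσ₀ β : PowerSeries (unitBall E)) with hQdef
  have hs := hasSubst_compSeriesC h2 hσ₀ u hε
  -- (1) `L(Q) − 1 = L(Q − 1)`
  have h1 : transport h2 u E hσ₀ j hε θ (Q - 1) = transport h2 u E hσ₀ j hε θ Q - 1 := by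
    unfold transport
    rw [map_sub (PowerSeries.map j), map_one, ← PowerSeries.coe_substAlgHom hs, map_sub, map_one, map_sub, map_one]
  -- (2) all coefficients of `j(Q − 1) ∘ ϑ` lie in `(j π')`
  set J : Ideal (UnrCoeff F) := Ideal.span {j (algebraMap 𝒪[F] (unitBall E) π')} with hJ
  have hQ := reflQuot_sub_one_mem (isUniformizer_unit_mul h2 u) E hq hE hσ₀ β
  have hmapj : ∀ n, PowerSeries.coeff n ((Q - 1).map j) ∈ J := fun n => by
    rw [PowerSeries.coeff_map]
    obtain ⟨b, hb⟩ := Ideal.mem_span_singleton'.mp (mem_coeffIdeal_iff.mp hQ n)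
    exact Ideal.mem_span_singleton'.mpr ⟨j b, by rw [← map_mul, hb]⟩
  have hsubst : ∀ n, PowerSeries.coeff n (PowerSeries.subst (compSeriesC h2 hσ₀ u hε) ((Q - 1).map j)) ∈ J := fun n => by
    rw [PowerSeries.coeff_subst' hs]
    exact finsum_induction (· ∈ J) J.zero_mem (fun _ _ hx hy => J.add_mem hx hy)
      fun d => by rw [smul_eq_mul]; exact J.mul_mem_right _ (hmapj d)
  -- (3) the generator reads `Θ(ι(u)) · 2`
  have hgen : ‖readΘ θ (j (algebraMap 𝒪[F] (unitBall E) π'))‖ ≤ ‖(2 : ℂ_[2])‖ := by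
    have e1 : j (algebraMap 𝒪[F] (unitBall E) π') = intToUnrCoeff F π' := RingHom.congr_fun hj (LTCoeff.of F π')
    rw [e1, hπ', map_mul, map_natCast, map_mul, map_natCast, Nat.cast_ofNat, norm_mul]
    calc ‖readΘ θ (intToUnrCoeff F (u : 𝒪[F]))‖ * ‖(2 : ℂ_[2])‖ ≤ 1 * ‖(2 : ℂ_[2])‖ :=
          mul_le_mul_of_nonneg_right (norm_readΘ_le θ hθ1 _) (norm_nonneg _)
      _ = ‖(2 : ℂ_[2])‖ := one_mul _
  -- (4) conclude
  rw [← h1]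
  show ‖PowerSeries.coeff k (PowerSeries.map (readΘ θ)
      (PowerSeries.subst (compSeriesC h2 hσ₀ u hε) ((Q - 1).map j)))‖ ≤ _
  rw [PowerSeries.coeff_map]
  obtain ⟨b, hb⟩ := Ideal.mem_span_singleton'.mp (hsubst k)
  rw [← hb, map_mul, norm_mul]
  calc ‖readΘ θ b‖ * ‖readΘ θ (j (algebraMap 𝒪[F] (unitBall E) π'))‖ ≤ 1 * ‖(2 : ℂ_[2])‖ :=
        mul_le_mul (norm_readΘ_le θ hθ1 b) hgen (norm_nonneg _) zero_le_one
    _ = ‖(2 : ℂ_[2])‖ := one_mul _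

omit [Normal F E] [IsGalois F E] in
/-- Unfolding `L` with `PowerSeries.map` heads. -/
theorem transport_eq (G : PowerSeries (unitBall E)) :
    transport h2 u E hσ₀ j hε θ G =
      PowerSeries.map (readΘ θ) (PowerSeries.subst (compSeriesC h2 hσ₀ u hε) (PowerSeries.map j G)) := rfl

omit [Normal F E] [IsGalois F E] in
/-- `L` is multiplicative. [folklore] -/
theorem transport_mul (G H : PowerSeries (unitBall E)) :
    transport h2 u E hσ₀ j hε θ (G * H) = transport h2 u E hσ₀ j hε θ G * transport h2 u E hσ₀ j hε θ H := by
  rw [transport_eq, transport_eq, transport_eq, map_mul (PowerSeries.map j),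
    PowerSeries.subst_mul (hasSubst_compSeriesC h2 hσ₀ u hε), map_mul]

omit [Normal F E] [IsGalois F E] in
/-- `L` is additive. [folklore] -/
theorem transport_add (G H : PowerSeries (unitBall E)) :
    transport h2 u E hσ₀ j hε θ (G + H) = transport h2 u E hσ₀ j hε θ G + transport h2 u E hσ₀ j hε θ H := by
  rw [transport_eq, transport_eq, transport_eq, map_add (PowerSeries.map j),
    PowerSeries.subst_add (hasSubst_compSeriesC h2 hσ₀ u hε), map_add]

/-- `d⁄dX` commutes with coefficientwise maps (private copy of a tree one-liner). [folklore] -/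
private theorem derivative_map' {R T : Type*} [CommRing R] [CommRing T] (φ : R →+* T) (G : PowerSeries R) :
    PowerSeries.derivative T (PowerSeries.map φ G) = PowerSeries.map φ (PowerSeries.derivative R G) := by
  ext n
  simp only [PowerSeries.coeff_derivative, PowerSeries.coeff_map, map_mul, map_add, map_natCast, map_one]

include hj in
/-- ★★ **H5 «TRANSPORTED D-IDENTITY» IS PROVED** (unconditionally): push §D's `2·(δβ)~·Q_β = ω_f·Q_β'` through the ring
map `L = Θ ∘ (∘ϑ) ∘ j`, use `(G∘ϑ)' = (G'∘ϑ)·ϑ'` (`PowerSeries.derivative_subst`) and the comparison chain rule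
`(1+S)ϑ' = ε·ω_{f'}(ϑ)` (Literature `comparisonChainRuleC` at `q = 2`, `ω_f = 1 + S` by `invDiff_ltPoly_two_eq`), and identify
`L(ω_f) = Θ(ω_{f'}∘ϑ)` by `hj`. [cite: deShalit1987, I.3.3 (8) (p. 17), I.3.5] [cite: LubinTate1965, Lemma p. 385] -/
theorem transportedDIdentity_holds : TransportedDIdentity h2 u E hq hE hσ₀ j hε θ := by
  intro β
  have hs : PowerSeries.HasSubst (compSeriesC h2 hσ₀ u hε) := hasSubst_compSeriesC h2 hσ₀ u hε
  -- the comparison chain rule at `q = 2`: `(1+S)·ϑ' = ε·ω_{f'}(ϑ)`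
  have hT3' := Literature.NumberTheory.GaloisRepresentations.comparisonChainRuleC h2 u hσ₀ hε
  rw [invDiff_ltPoly_two_eq hq h2, map_add, map_one, PowerSeries.map_X] at hT3'
  have hD := two_mul_relTildeSeries_mul_reflQuot (isUniformizer_unit_mul h2 u) E hq hE hσ₀ (of_unit_mul_two_eq hq u) β
  set Q : PowerSeries (unitBall E) :=
    (reflQuot (isUniformizer_unit_mul h2 u) E hq hE hσ₀ β : PowerSeries (unitBall E)) with hQ
  set T := relTildeSeries (isUniformizer_unit_mul h2 u) E hq hE hσ₀ (LTCoeff.of F (u : 𝒪[F])) β with hT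
  set ι := invDiff (isLTRing_LTCoeff (isUniformizer_unit_mul h2 u))
    (isLTSeries_LTCoeff ((u : 𝒪[F]) * ((2 : ℕ) : 𝒪[F]))) with hι
  set Sι : PowerSeries ℂ_[2] := PowerSeries.map (readΘ θ) (PowerSeries.subst (compSeriesC h2 hσ₀ u hε)
    (PowerSeries.map ((intToUnrCoeff F).comp (LTCoeff.of F).symm.toRingHom) ι)) with hSι
  set e : ℂ_[2] := readΘ θ (PowerSeries.coeff 1 (compSeriesC h2 hσ₀ u hε)) with he
  -- (i) `L(2·T·Q) = 2·L(T)·L(Q)`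
  have h1 : transport h2 u E hσ₀ j hε θ (2 * T * Q) =
      2 * transport h2 u E hσ₀ j hε θ T * transport h2 u E hσ₀ j hε θ Q := by
    rw [transport_mul, two_mul, transport_add, ← two_mul]
  -- (ii) `L(ω_f) = Θ(ω_{f'} ∘ ϑ)` (by `hj`)
  have h2' : transport h2 u E hσ₀ j hε θ (PowerSeries.map (algebraMap (LTCoeff F) (unitBall E)) ι) = Sι := by
    rw [transport_eq, ← RingHom.comp_apply (PowerSeries.map j), ← PowerSeries.map_comp, hj]
  have h3 : transport h2 u E hσ₀ j hε θ
        (PowerSeries.map (algebraMap (LTCoeff F) (unitBall E)) ι * PowerSeries.derivative (unitBall E) Q) =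
      Sι * transport h2 u E hσ₀ j hε θ (PowerSeries.derivative (unitBall E) Q) := by
    rw [transport_mul, h2']
  -- (iii) `(1+S)·(L Q)' = e · L(Q') · Θ(ω_{f'}∘ϑ)` (chain rule + comparison chain rule)
  have h4 : (1 + PowerSeries.X) * PowerSeries.derivative ℂ_[2] (transport h2 u E hσ₀ j hε θ Q) =
      PowerSeries.C e * transport h2 u E hσ₀ j hε θ (PowerSeries.derivative (unitBall E) Q) * Sι := by
    have h1X : (1 + PowerSeries.X : PowerSeries ℂ_[2]) = PowerSeries.map (readΘ θ) (1 + PowerSeries.X) := by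
      rw [map_add, map_one, PowerSeries.map_X]
    rw [transport_eq, transport_eq, derivative_map', PowerSeries.derivative_subst (UnrCoeff F) hs, derivative_map',
      h1X, ← map_mul, mul_left_comm, hT3', map_mul, map_mul, PowerSeries.map_C]
    ring
  -- (iv) assemble
  have hD' := congrArg (transport h2 u E hσ₀ j hε θ) hD
  rw [h1, h3] at hD'
  rw [h4, map_mul, map_ofNat]
  calc 2 * PowerSeries.C e * transport h2 u E hσ₀ j hε θ T * transport h2 u E hσ₀ j hε θ Q =
      PowerSeries.C e * (2 * transport h2 u E hσ₀ j hε θ T * transport h2 u E hσ₀ j hε θ Q) := by ring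
    _ = PowerSeries.C e * (Sι * transport h2 u E hσ₀ j hε θ (PowerSeries.derivative (unitBall E) Q)) := by rw [hD']
    _ = PowerSeries.C e * transport h2 u E hσ₀ j hε θ (PowerSeries.derivative (unitBall E) Q) * Sι := by ring


end Transport

end Summit.BirchSwinnertonDyer.Rank1Residual.P2.ReflectionPrimitive

end
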